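import Literature.Geometry.Kaehler.RiemannianHodge
import Literature.Geometry.Kaehler.HodgeStarProofs

/-!
# The Hodge star on a Riemannian manifold: `⋆⋆ = (-1)^{k(n-k)}` (proof)

This file discharges the named fact `Literature.Geometry.Kaehler.MForm.hodgeStar_hodgeStar` of
`Literature/Geometry/Kaehler/RiemannianHodge.lean`:

* `Literature.MForm.hodgeStar_hodgeStar_holds : MForm.hodgeStar_hodgeStar o` — for the Hodge star
  `⋆ : Ωᵏ(M) → Ωᵐ(M)` (`k + m = n`) of a Riemannian `n`-manifold with orientation family `o`,
  `⋆⋆α = (-1)^{km} α` for every `k`-form `α`.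

Source: F. W. Warner, *Foundations of Differentiable Manifolds and Lie Groups*, GTM 94, 6.1,
eq. (1), p. 220: on an oriented Riemannian manifold of dimension `n`, "`** = (-1)^{p(n-p)}` on
`E^p(M)`", which Warner obtains pointwise from the linear-algebra statement Ch. 2, Exercise 13 (5),
p. 80 ("on `Λ_p(V)`, `** = (-1)^{p(n-p)}`"). The same statement is Huybrechts, *Complex Geometry*,
Prop. 1.2.20 (iii), pp. 32–33 (`(*|_{ΛᵏV})² = (-1)^{k(d-k)}`), applied in every tangent space.

## Proof

`Literature.MForm.hodgeStar o h` acts pointwise by the linear-algebra star `Literature.hodgeStar (o x) h`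
(`MForm.hodgeStar_apply`, definitional), so the identity is the pointwise fact
`Literature.Geometry.Kaehler.hodgeStar_hodgeStar`, discharged as `Literature.Geometry.Kaehler.hodgeStar_hodgeStar_holds` in
`Literature/Geometry/Kaehler/HodgeStarProofs.lean`, evaluated at each `x : M`. This is exactly the
interim proof preserved (commented) under the fact in `RiemannianHodge.lean`.

## References

* F. W. Warner, *Foundations of Differentiable Manifolds and Lie Groups*, GTM 94, Springer (1983),
  6.1 (1), p. 220; Ch. 2, Exercise 13 (5), p. 80.
* D. Huybrechts, *Complex Geometry. An Introduction*, Universitext, Springer (2005),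
  Prop. 1.2.20 (iii), pp. 32–33; Appendix A, pp. 281–286 (the Hodge `*`-operator
  `𝒜ᵏ(M) → 𝒜^{m-k}(M)` of an oriented Riemannian manifold).
-/

noncomputable section

open scoped Manifold
open Bundle Module

namespace Literature.Geometry.Kaehler

variable {E : Type*} [NormedAddCommGroup E] [NormedSpace ℝ E] {n : ℕ} [Fact (finrank ℝ E = n)]
  {H : Type*} [TopologicalSpace H] {I : ModelWithCorners ℝ E H}
  {M : Type*} [TopologicalSpace M] [ChartedSpace H M]
  [FiniteDimensional ℝ E] [RiemannianBundle (fun x : M ↦ TangentSpace I x)] {k m : ℕ}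
  (o : (x : M) → Orientation ℝ (TangentSpace I x) (Fin n))

/-- **Discharge of `Literature.Geometry.Kaehler.MForm.hodgeStar_hodgeStar`**: on `k`-forms of a Riemannian `n`-manifold
with orientation family `o`, `⋆⋆ = (-1)^{km}` where `k + m = n`. Warner, *Foundations of
Differentiable Manifolds and Lie Groups*, 6.1 (1), p. 220 (`** = (-1)^{p(n-p)}` on `E^p(M)`),
pointwise from Ch. 2, Exercise 13 (5), p. 80; Huybrechts, *Complex Geometry*, Prop. 1.2.20 (iii),
pp. 32–33. [cite: WarnerGTM94, 6.1 (1), p. 220; Ch. 2 Ex. 13 (5), p. 80] -/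
theorem MForm.hodgeStar_hodgeStar_holds : MForm.hodgeStar_hodgeStar o (k := k) (m := m) := by
  intro h h' α
  funext x
  rw [MForm.hodgeStar_apply, MForm.hodgeStar_apply, Pi.smul_apply]
  exact Literature.Geometry.Kaehler.hodgeStar_hodgeStar_holds (o x) h h' (α x)

end Literature.Geometry.Kaehler
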